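import Summits.AnomalousDissipation.AnomalousDissipation.Theorems.SolenoidalFractalHomogenisationLagrangianStepVmodSolenoidalClass
import Summits.AnomalousDissipation.AnomalousDissipation.Theorems.SolenoidalFractalHomogenisationLagrangianStepVmodDistortedAssembly
import Summits.AnomalousDissipation.AnomalousDissipation.Theorems.SolenoidalFractalHomogenisationLagrangianStepLossCurrencyForm
import Literature.Analysis.FluidPDE.NSHopfLimit
import Literature.Analysis.FluidPDE.PassiveVectorTensorDistortedFramePairing
import HarnessLib

/-!
# K1L_D (stmt-AnomalousDissipation-27980), (ℓ3-A) road A: the TWISTED ASSEMBLY of the J-CUT — four `BlockBoundGJ` blocks and `NearMultGJ` give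
# `SlowVectorClauseModECW0FJ` (prover ad-k1loc-p3 g11, `--supports 27980 --as helper`; RULING D28-18 (2) «ASSEMBLY PORT», F-p3g11-3 / tenure ACK 14:25:33Z:
# target = the clause UNDER the `J`-binder; head twin `vmod_EX_of_VRH0FJ` is lead g7's)

Port of `VmodDist.modECW0_of_blockBoundsG_at` (p712075, lead g6) — the data split and the 2×2 loss-currency bookkeeping VERBATIM — with the
TEST handled through the frame: `ζ ↦ ζ* := P_{K(G t)} ζ` (orthogonal projection onto the `G(t)`-solenoidal closed class `VmodDist.solClass (G t)`,
`…VmodSolenoidalClass`): `⟪U x − T x, ζ⟫ = ⟪U x − T x, ζ*⟫` and `q*_T(ζ*) ≤ q*_T(ζ)` (`…LossCurrencyForm`); then the TWISTED SPLIT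
`ζ* = J(t)•φs + J(t)•φf` (`exists_twistedSplit`: `φ* := G(t)•ζ*` is flat weakly divergence free, split by the flat label projector of
`…LabelSplit.exists_labelProj`, weak divergence-freeness of the pieces by the Fourier criterion, `J(G ζ*) = ζ*` from `G J = 1`); the four blocks on
`(xs|xf) × (J•φs|J•φf)`; test-loss sub-additivity from the LOSS-FORM cross bound of `NearMultGJ` (`loss_split_le_of_lossForm`, no orthogonality).
* §1 `loss_split_le_of_lossForm`; §2 `exists_twistedSplit`; §3 **`modECW0FJ_of_blockBoundsGJ_at`**.
`sorry`-free; NOT a proof of any block, of (M_θ), of `stub_Vmod_EHTthg`, of K1L_D or of AD; rung F-D1.A0.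
-/

set_option linter.dupNamespace false

noncomputable section

namespace Summit.AnomalousDissipation.AnomalousDissipation.Theorems.SolenoidalFractalHomogenisation.LagrangianStep.VmodDist

open Literature.Analysis Literature.Analysis.FluidPDE Literature.Analysis.FunctionSpaces
open MeasureTheory Set UnitAddTorus
open scoped InnerProductSpace
open Summit.AnomalousDissipation.AnomalousDissipation.Theorems.SolenoidalFractalHomogenisation.LagrangianStep.CellClauseMod
open Summit.AnomalousDissipation.AnomalousDissipation.Theorems.SolenoidalFractalHomogenisation.LagrangianStep.LossCurrency
open Summit.AnomalousDissipation.AnomalousDissipation.Theorems.SolenoidalFractalHomogenisation.LagrangianStep.VmodFlat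
  (IsSlow IsFast fc fc_sub inner_eq_zero_of_fc_disjoint eta_sum_le)

/-! ## §1 Sub-additivity of the losses from a loss-form cross bound -/

/-- **Losses are sub-additive when the LOSS-FORM cross term is loss-dominated** (no orthogonality needed): for a bounded `T`,
`|⟪a,b⟫ − ⟪T a, T b⟫| ≤ κ√q(a)√q(b)` with `0 ≤ κ < 1` and `q(a), q(b) ≥ 0` give `q(a) + q(b) ≤ q(a+b)/(1−κ)` (`q = ‖·‖² − ‖T·‖²`). -/
theorem loss_split_le_of_lossForm {H : Type*} [NormedAddCommGroup H] [InnerProductSpace ℝ H] (T : H →L[ℝ] H) {a b : H} {κ : ℝ}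
    (hκ0 : 0 ≤ κ) (hκ : κ < 1) (hqa : 0 ≤ ‖a‖ ^ 2 - ‖T a‖ ^ 2) (hqb : 0 ≤ ‖b‖ ^ 2 - ‖T b‖ ^ 2)
    (hcross : |⟪a, b⟫_ℝ - ⟪T a, T b⟫_ℝ| ≤ κ * Real.sqrt (‖a‖ ^ 2 - ‖T a‖ ^ 2) * Real.sqrt (‖b‖ ^ 2 - ‖T b‖ ^ 2)) :
    (‖a‖ ^ 2 - ‖T a‖ ^ 2) + (‖b‖ ^ 2 - ‖T b‖ ^ 2) ≤ (‖a + b‖ ^ 2 - ‖T (a + b)‖ ^ 2) / (1 - κ) := by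
  set A : ℝ := ‖a‖ ^ 2 - ‖T a‖ ^ 2 with hA
  set B : ℝ := ‖b‖ ^ 2 - ‖T b‖ ^ 2 with hB
  have hgm : Real.sqrt A * Real.sqrt B ≤ (A + B) / 2 := by
    have hsa := Real.sq_sqrt hqa
    have hsb := Real.sq_sqrt hqb
    nlinarith [sq_nonneg (Real.sqrt A - Real.sqrt B), Real.sqrt_nonneg A, Real.sqrt_nonneg B]
  have hcr : -(κ * ((A + B) / 2)) ≤ ⟪a, b⟫_ℝ - ⟪T a, T b⟫_ℝ := by
    have h := (neg_abs_le _).trans' (neg_le_neg hcross)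
    have : κ * Real.sqrt A * Real.sqrt B ≤ κ * ((A + B) / 2) := by
      rw [mul_assoc]; exact mul_le_mul_of_nonneg_left hgm hκ0
    linarith
  rw [loss_add_eq, le_div_iff₀ (by linarith)]
  nlinarith [hcr, hqa, hqb]

/-! ## §2 The twisted split of a `G(t)`-solenoidal test -/

/-- Slices of a field whose iterated `y`-derivatives are jointly continuous are continuous (order `0`). -/
theorem continuous_entry_of_jointCont {F : ℝ → UnitAddTorus (Fin 3) → Matrix (Fin 3) (Fin 3) ℝ}
    (hF : ∀ i j (l : List (Fin 3)), Continuous (Function.uncurry fun t y => Torus.iterPartialDeriv l (fun y => F t y i j) y))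
    (t : ℝ) (i j : Fin 3) : Continuous fun y => F t y i j := by
  have h := hF i j []
  simp only [Torus.iterPartialDeriv_nil] at h
  exact h.comp (continuous_const.prodMk continuous_id)

set_option maxHeartbeats 800000 in
/-- **The twisted split**: a `G(t)`-solenoidal class `ζ' ∈ solClass (G t)` is the sum of two frame-corrected tests `corrTest (J t) φs + corrTest (J t) φf`
with `φs` slow, `φf` fast (flat classes at resolution `n`), both weakly divergence free (`φ* := G(t)•ζ'`, split by the flat label projector;
`J(t)•φ* = ζ'` from `G J = 1`). -/
theorem exists_twistedSplit {θ Tw nC : ℝ} {G J : ℝ → UnitAddTorus (Fin 3) → Matrix (Fin 3) (Fin 3) ℝ} (hR : IsFrameRegular θ Tw nC G J)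
    (n : ℕ) (t : ℝ) {ζ' : V2} (hζ' : ζ' ∈ solClass (G t)) :
    ∃ φs φf : V2, ζ' = corrTest (J t) φs + corrTest (J t) φf ∧ IsSlow n φs ∧ IsFast n φf ∧
      Torus.IsWeaklyDivFree ((φs : V2) : VF) ∧ Torus.IsWeaklyDivFree ((φf : V2) : VF) := by
  classical
  have hGt : ∀ a c, Continuous fun y => G t y a c := fun a c => continuous_entry_of_jointCont hR.jointContG t a c
  have hJt : ∀ a c, Continuous fun y => J t y a c := fun a c => continuous_entry_of_jointCont hR.jointCont t a c
  -- `φ* := G(t)•ζ'`, a flat weakly divergence-free `L²` field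
  have hφF : MemLp (Torus.distort (G t) ((ζ' : V2) : VF)) 2 volume := memLp_two_distort hGt (Lp.memLp ζ')
  set φ : V2 := hφF.toLp _ with hφdef
  have hφae : ((φ : V2) : VF) =ᵐ[volume] Torus.distort (G t) ((ζ' : V2) : VF) := hφF.coeFn_toLp
  have hφdivF : Torus.IsWeaklyDivFree (Torus.distort (G t) ((ζ' : V2) : VF)) := (mem_solClass_iff hGt ζ').1 hζ'
  have hφdiv : Torus.IsWeaklyDivFree ((φ : V2) : VF) := hφdivF.congr_ae hφae.symm
  -- the flat label split at `freqBall (n/4)`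
  set A : Set (Fin 3 → ℤ) := ↑(Torus.freqBall (d := Fin 3) (n / 4)) with hA
  have hAsym : ∀ k', k' ∈ A ↔ -k' ∈ A := fun k' => by
    rw [hA, Finset.mem_coe, Finset.mem_coe, Torus.neg_mem_freqBall]
  obtain ⟨P, hP⟩ := exists_labelProj A hAsym
  set φs : V2 := P φ with hφs
  set φf : V2 := φ - P φ with hφf
  have hsum : φs + φf = φ := by rw [hφs, hφf]; abel
  have hφs_s : IsSlow n φs := fun k' hk' => by
    have h := hP φ k'
    rw [if_neg (by rwa [hA, Finset.mem_coe] : k' ∉ A)] at h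
    exact h
  have hPon : ∀ k', k' ∈ Torus.freqBall (d := Fin 3) (n / 4) → fc (P φ) k' = fc φ k' := fun k' hk' => by
    have h := hP φ k'
    rw [if_pos (by rwa [hA, Finset.mem_coe] : k' ∈ A)] at h
    exact h
  have hφf_f : IsFast n φf := fun k' hk' => by rw [hφf, fc_sub, hPon k' hk', sub_self]
  -- weak divergence-freeness of the pieces (Fourier criterion)
  have hkφ : ∀ k', ∑ j, ((k' j : ℤ) : ℂ) * mFourierCoeff (EuclideanSpace.complexify ∘ ((φ : V2) : VF)) k' j = 0 :=
    fun k' => hφdiv.sum_mul_mFourierCoeff_eq_zero (Lp.memLp φ) k'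
  have hφs_div : Torus.IsWeaklyDivFree ((φs : V2) : VF) := by
    refine Torus.isWeaklyDivFree_of_sum_mul_mFourierCoeff_eq_zero (Lp.memLp φs) fun k' => ?_
    have h := hP φ k'
    by_cases hk' : k' ∈ A
    · rw [if_pos hk'] at h
      rw [show (fun j => ((k' j : ℤ) : ℂ) * mFourierCoeff (EuclideanSpace.complexify ∘ ((φs : V2) : VF)) k' j)
          = fun j => ((k' j : ℤ) : ℂ) * mFourierCoeff (EuclideanSpace.complexify ∘ ((φ : V2) : VF)) k' j from funext fun j => by rw [hφs, h]]
      exact hkφ k'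
    · rw [if_neg hk'] at h
      simp [hφs, h]
  have hφf_div : Torus.IsWeaklyDivFree ((φf : V2) : VF) := by
    refine Torus.isWeaklyDivFree_of_sum_mul_mFourierCoeff_eq_zero (Lp.memLp φf) fun k' => ?_
    have hsub : ∀ j, mFourierCoeff (EuclideanSpace.complexify ∘ ((φf : V2) : VF)) k' j
        = mFourierCoeff (EuclideanSpace.complexify ∘ ((φ : V2) : VF)) k' j - mFourierCoeff (EuclideanSpace.complexify ∘ ((φs : V2) : VF)) k' j := by
      intro j
      have e : fc φf k' = fc φ k' - fc φs k' := by rw [hφf, fc_sub]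
      exact congrArg (fun z : EuclideanSpace ℂ (Fin 3) => z j) e
    have h1 := hkφ k'
    have h2 : ∑ j, ((k' j : ℤ) : ℂ) * mFourierCoeff (EuclideanSpace.complexify ∘ ((φs : V2) : VF)) k' j = 0 :=
      hφs_div.sum_mul_mFourierCoeff_eq_zero (Lp.memLp φs) k'
    simp only [hsub, mul_sub, Finset.sum_sub_distrib, h1, h2, sub_zero]
  -- `J(t)•φs + J(t)•φf = J(t)•(G(t)•ζ') = ζ'`
  have hJG : ∀ y, J t y * G t y = 1 := fun y => mul_eq_one_comm.1 (hR.mul_eq_one t y)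
  have hms : MemLp (Torus.distort (J t) ((φs : V2) : VF)) 2 volume := memLp_two_distort hJt (Lp.memLp φs)
  have hmf : MemLp (Torus.distort (J t) ((φf : V2) : VF)) 2 volume := memLp_two_distort hJt (Lp.memLp φf)
  refine ⟨φs, φf, ?_, hφs_s, hφf_f, hφs_div, hφf_div⟩
  refine Lp.ext_iff.2 ?_ |>.symm
  have h1 : ((corrTest (J t) φs + corrTest (J t) φf : V2) : VF) =ᵐ[volume] ((corrTest (J t) φs : V2) : VF) + ((corrTest (J t) φf : V2) : VF) :=
    Lp.coeFn_add _ _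
  have h2 := coeFn_corrTest hms
  have h3 := coeFn_corrTest hmf
  have h4 : ((φ : V2) : VF) =ᵐ[volume] ((φs : V2) : VF) + ((φf : V2) : VF) := by rw [← hsum]; exact Lp.coeFn_add _ _
  filter_upwards [h1, h2, h3, h4, hφae] with y hy1 hy2 hy3 hy4 hy5
  rw [hy1, Pi.add_apply, hy2, hy3, ← Pi.add_apply (Torus.distort (J t) _) (Torus.distort (J t) _) y, ← Torus.distort_add]
  have e : Torus.distort (J t) (((φs : V2) : VF) + ((φf : V2) : VF)) y = Torus.distort (J t) ((φ : V2) : VF) y := by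
    simp only [Torus.distort, hy4]
  rw [e]
  have e2 : Torus.distort (J t) ((φ : V2) : VF) y = Torus.distort (J t) (Torus.distort (G t) ((ζ' : V2) : VF)) y := by
    simp only [Torus.distort, hy5]
  rw [e2, Torus.distort_distort_of_mul_eq_one hJG]

/-! ## §3 The twisted assembly -/

set_option maxHeartbeats 1600000 in
/-- **(ℓ3-A) TWISTED ASSEMBLY, pointwise (J-CUT)**: `NearMultGJ … κ` (`0 ≤ κ < 1`) and the four `BlockBoundGJ` blocks give
`SlowVectorClauseModECW0FJ … ((C₁+C₂+C₃+C₄)/(1−κ)) …` — the clause under the `J`-binder (F-p3g11-3); body of p712075 with the test seen through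
`P_{solClass (G t)}` and the twisted split. -/
theorem modECW0FJ_of_blockBoundsGJ_at {k : ℕ} (W : LatticeShear.LatticeWord k) (M : ℝ) (hM : 0 < M) {c : ℝ}
    (Φ : ℝ → Torus.Visc4 (Fin 3) → Torus.Visc4 (Fin 3)) {lo hi Λ β σ' C₁ C₂ C₃ C₄ ν₀ K θ₁ ϱ₁ κ : ℝ}
    (hκ0 : 0 ≤ κ) (hκ : κ < 1) (hC₁ : 0 ≤ C₁) (hC₂ : 0 ≤ C₂) (hC₃ : 0 ≤ C₃) (hC₄ : 0 ≤ C₄)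
    (hNM : NearMultGJ c Φ lo hi Λ β ν₀ K θ₁ ϱ₁ κ)
    (B₁ : BlockBoundGJ W M hM c Φ lo hi Λ β σ' C₁ ν₀ K θ₁ ϱ₁ IsSlow IsSlow) (B₂ : BlockBoundGJ W M hM c Φ lo hi Λ β σ' C₂ ν₀ K θ₁ ϱ₁ IsSlow IsFast)
    (B₃ : BlockBoundGJ W M hM c Φ lo hi Λ β σ' C₃ ν₀ K θ₁ ϱ₁ IsFast IsSlow) (B₄ : BlockBoundGJ W M hM c Φ lo hi Λ β σ' C₄ ν₀ K θ₁ ϱ₁ IsFast IsFast) :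
    SlowVectorClauseModECW0FJ W M hM c Φ lo hi Λ β σ' ((C₁ + C₂ + C₃ + C₄) / (1 - κ)) ν₀ K θ₁ ϱ₁ := by
  intro ν hν n hn 𝔸 hodd hwin hΦo hΦw θ hθ nC hnC0 hnC Tw hTw G hG J hR U T hU hT t ht0 htT x ζ
  have hGt : ∀ a c', Continuous fun y => G t y a c' := fun a c' => continuous_entry_of_jointCont hR.jointContG t a c'
  -- the DATUM split at the frequency ball `freqBall (n/4)` (flat classes at the reset; verbatim)
  set A : Set (Fin 3 → ℤ) := ↑(Torus.freqBall (d := Fin 3) (n / 4)) with hA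
  have hAsym : ∀ k', k' ∈ A ↔ -k' ∈ A := fun k' => by
    rw [hA, Finset.mem_coe, Finset.mem_coe, Torus.neg_mem_freqBall]
  obtain ⟨P, hP⟩ := exists_labelProj A hAsym
  have hPoff : ∀ (y : V2) (k' : Fin 3 → ℤ), k' ∉ Torus.freqBall (d := Fin 3) (n / 4) → fc (P y) k' = 0 := by
    intro y k' hk'
    have h := hP y k'
    rw [if_neg (by rwa [hA, Finset.mem_coe] : k' ∉ A)] at h
    exact h
  have hPon : ∀ (y : V2) (k' : Fin 3 → ℤ), k' ∈ Torus.freqBall (d := Fin 3) (n / 4) → fc (P y) k' = fc y k' := by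
    intro y k' hk'
    have h := hP y k'
    rw [if_pos (by rwa [hA, Finset.mem_coe] : k' ∈ A)] at h
    exact h
  set xs : V2 := P x with hxs
  set xf : V2 := x - P x with hxf
  have hx : x = xs + xf := by rw [hxs, hxf]; abel
  have hxs_s : IsSlow n xs := fun k' hk' => hPoff x k' hk'
  have hxf_f : IsFast n xf := fun k' hk' => by rw [hxf, fc_sub, hPon x k' hk', sub_self]
  have disj : ∀ {y y' : V2}, IsSlow n y → IsFast n y' → ∀ k', fc y k' = 0 ∨ fc y' k' = 0 := by
    intro y y' hy hy' k'
    by_cases hk' : k' ∈ Torus.freqBall (d := Fin 3) (n / 4)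
    · exact Or.inr (hy' k' hk')
    · exact Or.inl (hy k' hk')
  have hox : ⟪xs, xf⟫_ℝ = 0 := inner_eq_zero_of_fc_disjoint (disj hxs_s hxf_f)
  -- the TEST: projection onto the `G(t)`-solenoidal class, then the twisted split
  set Kt : Submodule ℝ V2 := solClass (G t) with hKt
  haveI : Kt.HasOrthogonalProjection := hasOrthogonalProjection_solClass (G t)
  have hrangeT : ∀ y : V2, T 0 t y ∈ Kt := fun y => hT.toIsDistortedPropagator.apply_mem_solClass hGt 0 y
  have hrangeU : ∀ y : V2, U 0 t y ∈ Kt := fun y => hU.toIsDistortedPropagator.apply_mem_solClass hGt 0 y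
  set ζ' : V2 := Kt.starProjection ζ with hζ'
  have hζ'K : ζ' ∈ Kt := Kt.starProjection_apply_mem ζ
  obtain ⟨φs, φf, hsplitζ, hφs_s, hφf_f, hφs_div, hφf_div⟩ := exists_twistedSplit hR n t hζ'K
  set ψs : V2 := corrTest (J t) φs with hψs
  set ψf : V2 := corrTest (J t) φf with hψf
  -- the coarse member: contraction, nonnegative losses, near-multiplier cross bounds
  have hTc : ∀ y, ‖T 0 t y‖ ≤ ‖y‖ := hT.norm_le 0 t
  have hq0 : ∀ y, 0 ≤ lossFwd (T 0 t) y := fun y => loss_nonneg hTc y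
  have hqs0 : ∀ y, 0 ≤ lossAdj (T 0 t) y := fun y => lossAdj_nonneg hTc y
  obtain ⟨hNMf, hNMa⟩ := hNM ν hν n hn 𝔸 hodd hwin hΦo hΦw θ hθ nC hnC0 hnC Tw hTw G hG J hR T hT t ht0 htT
  have hsplit : lossFwd (T 0 t) xs + lossFwd (T 0 t) xf ≤ lossFwd (T 0 t) x / (1 - κ) := by
    unfold lossFwd; rw [hx]
    exact loss_split_le_of_nearMult (T 0 t) hκ0 hκ hox (hq0 xs) (hq0 xf) (hNMf xs xf hxs_s hxf_f)
  have hsplitA : lossAdj (T 0 t) ψs + lossAdj (T 0 t) ψf ≤ lossAdj (T 0 t) ζ / (1 - κ) := by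
    have hTa : ∀ y, ‖ContinuousLinearMap.adjoint (T 0 t) y‖ ≤ ‖y‖ := norm_adjoint_le hTc
    have h1 : lossAdj (T 0 t) ψs + lossAdj (T 0 t) ψf ≤ lossAdj (T 0 t) ζ' / (1 - κ) := by
      unfold lossAdj; rw [hsplitζ]
      exact loss_split_le_of_lossForm (ContinuousLinearMap.adjoint (T 0 t)) hκ0 hκ (loss_nonneg hTa ψs) (loss_nonneg hTa ψf)
        (hNMa φs φf hφs_s hφf_f hφs_div hφf_div)
    have h2 : lossAdj (T 0 t) ζ' ≤ lossAdj (T 0 t) ζ := by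
      unfold lossAdj; rw [hζ']; exact lossAdj_starProjection_le Kt hrangeT ζ
    exact h1.trans (div_le_div_of_nonneg_right h2 (by linarith))
  -- the four block bounds at the pieces
  have b₁₁ := B₁ ν hν n hn 𝔸 hodd hwin hΦo hΦw θ hθ nC hnC0 hnC Tw hTw G hG J hR U T hU hT t ht0 htT xs φs hxs_s hφs_s hφs_div
  have b₁₂ := B₂ ν hν n hn 𝔸 hodd hwin hΦo hΦw θ hθ nC hnC0 hnC Tw hTw G hG J hR U T hU hT t ht0 htT xs φf hxs_s hφf_f hφf_div
  have b₂₁ := B₃ ν hν n hn 𝔸 hodd hwin hΦo hΦw θ hθ nC hnC0 hnC Tw hTw G hG J hR U T hU hT t ht0 htT xf φs hxf_f hφs_s hφs_div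
  have b₂₂ := B₄ ν hν n hn 𝔸 hodd hwin hΦo hΦw θ hθ nC hnC0 hnC Tw hTw G hG J hR U T hU hT t ht0 htT xf φf hxf_f hφf_f hφf_div
  -- common currency
  set a : ℝ := ν ^ σ' + ((⌈K / ν⌉₊ : ℝ) / n) ^ σ' + θ ^ σ' + (nC / n) ^ σ' with ha_def
  set m : ℝ := (min 1 ((M * W.period / ν) / t)) ^ σ' with hm_def
  have ha0 : 0 ≤ a := by
    have h1 : 0 ≤ ν ^ σ' := Real.rpow_nonneg hν.1.le σ'
    have h2 : 0 ≤ ((⌈K / ν⌉₊ : ℝ) / n) ^ σ' := Real.rpow_nonneg (by positivity) σ'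
    have h3 : 0 ≤ θ ^ σ' := Real.rpow_nonneg hθ.1 σ'
    have h4 : 0 ≤ (nC / n) ^ σ' := Real.rpow_nonneg (div_nonneg hnC0 (Nat.cast_nonneg n)) σ'
    rw [ha_def]; linarith
  have hP0 : 0 ≤ (M * W.period / ν) / t :=
    div_nonneg (div_nonneg (mul_nonneg hM.le
      (Summit.AnomalousDissipation.AnomalousDissipation.Theorems.SolenoidalFractalHomogenisation.PermissibleCarrier.period_pos W).le) hν.1.le) ht0.le
  have hm0 : 0 ≤ m := by rw [hm_def]; exact Real.rpow_nonneg (le_min zero_le_one hP0) σ'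
  have hη0 : ∀ {Cb : ℝ}, 0 ≤ Cb → 0 ≤ Cb * (Cb * a + m) := fun hCb => mul_nonneg hCb (by positivity)
  -- the test is seen only through its projection: `⟪U x − T x, ζ⟫ = ⟪U x − T x, ζ'⟫`
  have hvK : U 0 t x - T 0 t x ∈ Kt := Kt.sub_mem (hrangeU x) (hrangeT x)
  have hpair : ⟪U 0 t x - T 0 t x, ζ⟫_ℝ = ⟪U 0 t x - T 0 t x, ζ'⟫_ℝ := by
    rw [hζ']; exact inner_eq_inner_starProjection_of_mem Kt hvK ζ
  -- bilinear expansion and the 2×2 bookkeeping with `A² = q(x)/(1−κ)`, `B² = q*(ζ)/(1−κ)`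
  have hκ1 : 0 < 1 - κ := by linarith
  have hlin : U 0 t x - T 0 t x = (U 0 t xs - T 0 t xs) + (U 0 t xf - T 0 t xf) := by
    rw [hx, map_add, map_add]; abel
  have key := lossBound_add_blocks (v₁ := U 0 t xs - T 0 t xs) (v₂ := U 0 t xf - T 0 t xf) (ζ₁ := ψs) (ζ₂ := ψf)
    (A := Real.sqrt (lossFwd (T 0 t) x / (1 - κ))) (B := Real.sqrt (lossAdj (T 0 t) ζ / (1 - κ)))
    b₁₁ b₁₂ b₂₁ b₂₂ (hη0 hC₁) (hη0 hC₂) (hη0 hC₃) (hη0 hC₄)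
    (Real.sqrt_nonneg _) (Real.sqrt_nonneg _) (Real.sqrt_nonneg _) (Real.sqrt_nonneg _)
    (by rw [Real.sq_sqrt (hq0 xs), Real.sq_sqrt (hq0 xf), Real.sq_sqrt (div_nonneg (hq0 x) hκ1.le)]; exact hsplit)
    (by rw [Real.sq_sqrt (hqs0 ψs), Real.sq_sqrt (hqs0 ψf), Real.sq_sqrt (div_nonneg (hqs0 ζ) hκ1.le)]; exact hsplitA)
  rw [hpair, hsplitζ, hlin]
  refine key.trans ?_
  have hsum := eta_sum_le (m := m) hC₁ hC₂ hC₃ hC₄ ha0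
  set S : ℝ := C₁ + C₂ + C₃ + C₄ with hS
  have hS0 : 0 ≤ S := by rw [hS]; linarith
  have hsq : Real.sqrt (lossFwd (T 0 t) x / (1 - κ)) * Real.sqrt (lossAdj (T 0 t) ζ / (1 - κ))
      = (Real.sqrt (lossFwd (T 0 t) x) * Real.sqrt (lossAdj (T 0 t) ζ)) / (1 - κ) := by
    rw [Real.sqrt_div' _ hκ1.le, Real.sqrt_div' _ hκ1.le, div_mul_div_comm, Real.mul_self_sqrt hκ1.le]
  have hXY : 0 ≤ Real.sqrt (lossFwd (T 0 t) x) * Real.sqrt (lossAdj (T 0 t) ζ) := by positivity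
  have hinv1 : 1 ≤ 1 / (1 - κ) := by rw [le_div_iff₀ hκ1]; linarith
  have hCm : S * (S * a + m) / (1 - κ) ≤ S / (1 - κ) * (S / (1 - κ) * a + m) := by
    rw [div_eq_mul_one_div S, show S * (S * a + m) / (1 - κ) = S * (1 / (1 - κ)) * (S * a + m) by ring]
    refine mul_le_mul_of_nonneg_left ?_ (by positivity)
    have : S * a ≤ S * (1 / (1 - κ)) * a := by
      have := mul_le_mul_of_nonneg_left hinv1 (mul_nonneg hS0 ha0)
      nlinarith [this]
    linarith
  calc (C₁ * (C₁ * a + m) + C₂ * (C₂ * a + m) + C₃ * (C₃ * a + m) + C₄ * (C₄ * a + m))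
        * Real.sqrt (lossFwd (T 0 t) x / (1 - κ)) * Real.sqrt (lossAdj (T 0 t) ζ / (1 - κ))
      = (C₁ * (C₁ * a + m) + C₂ * (C₂ * a + m) + C₃ * (C₃ * a + m) + C₄ * (C₄ * a + m))
        * (Real.sqrt (lossFwd (T 0 t) x / (1 - κ)) * Real.sqrt (lossAdj (T 0 t) ζ / (1 - κ))) := by ring
    _ ≤ (S * (S * a + m)) * (Real.sqrt (lossFwd (T 0 t) x / (1 - κ)) * Real.sqrt (lossAdj (T 0 t) ζ / (1 - κ))) :=
          mul_le_mul_of_nonneg_right hsum (by positivity)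
    _ = (S * (S * a + m) / (1 - κ)) * (Real.sqrt (lossFwd (T 0 t) x) * Real.sqrt (lossAdj (T 0 t) ζ)) := by rw [hsq]; ring
    _ ≤ (S / (1 - κ) * (S / (1 - κ) * a + m)) * (Real.sqrt (lossFwd (T 0 t) x) * Real.sqrt (lossAdj (T 0 t) ζ)) :=
          mul_le_mul_of_nonneg_right hCm hXY
    _ = S / (1 - κ) * (S / (1 - κ) * a + m) * Real.sqrt (lossFwd (T 0 t) x) * Real.sqrt (lossAdj (T 0 t) ζ) := by ring

end Summit.AnomalousDissipation.AnomalousDissipation.Theorems.SolenoidalFractalHomogenisation.LagrangianStep.VmodDist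

end
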